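import Summits.Ventures.Crystal3D.Theorems.StickyWulffConstantCoaxialWallLawNotTriadicWith
import Summits.Ventures.Crystal3D.Theorems.StickyWulffConstantCoaxialWallLawWideSlotWith
import Summits.Ventures.Crystal3D.Theorems.StickyWulffConstantCoaxialWallLawTwinWideWith
import Summits.Ventures.Crystal3D.Theorems.StickyWulffConstantCoaxialWallLawReachCoreOfRowsA
import HarnessLib

/-!
# Restatement programme: the ASSEMBLY at explicit constants — F-U at `R₀ = 10` from the reach core in the With-currency

HONEST FRAMING. Venture `Summits/Ventures/Crystal3D` (cell `crystal3d-full`); helper for the crux `TextureLiminf` (stmt-Ventures-19483,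
line `TexShadow`, v6.20 `stub_coaxialUnif : ∃ C, CoaxialUnifAt C 10`) and lane F's debt F-U (cf-p1 DECISION (lxvii), 2026-08-29).
Pure re-assembly (census-free, standard axioms); F-C1 not moved; E1 (`ExactOnly` / `P5Exhaustion`) and `StarPairFar` stay BY NAME.
This is `coaxialTwoSlabAdhesion_of_vicinal` / `…_of_reach` / `coaxialTwoSlabAdhesionReach_of_split` (…VicinalCore, …VicinalReachCore)
in the explicit-constant currency `CoaxialTwoSlabAdhesionOnWith C 10 S` of `…LedgerWithDefs`, fed by the restated reach-cone links
(`coaxialOnWith_of_not_triadic`, `…_of_twin_wide`, `…_of_wide_slot`, `…_of_offReach`):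

* `coaxialOnWith_univ_of_vicinalWith` — the vicinal core at `(C_V, 10)` ⇒ ALL pairs at one `C`;
* `coaxialOnWith_vicinal_of_reachWith` — the reach core at `(C_R, 10)` ⇒ the vicinal core at one `C`;
* `coaxialOnWith_reach_of_splitWith` — the three reach debts R1/R2/R3 at `(Cᵢ, 10)` ⇒ the reach core at `max`;
* **`coaxialTwoSlabAdhesionUnifAt_ten_of_reachWith`** / **`…_of_splitWith`** (+ `_p5` forms): lane F's UNIFORM law
  `∃ C, CoaxialTwoSlabAdhesionUnifAt C 10` from the reach core / the three reach debts in the With-currency.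

WHAT REMAINS for F-U by name: the three reach debts AT explicit constants — R1/R2 = the ROW cone (census rows `EndRowTwinHalfTurnA` /
`EndRowTransA` through `…DebtTwinRowA` / `…DebtFaultRowA`, owner 19481-p1 per (lxvii)), R3 = the deep debt (`…VicinalDeepSplit`).
-/

noncomputable section

namespace Summit.Ventures.Crystal3D.Theorems

open Summit.Ventures.Crystal3D Finset
open Literature.MathematicalPhysics.StatisticalMechanics (fccStacking barlowStacking IsHaggSeq contactDeficiency)
open scoped InnerProductSpace

/-- Weakening the constant inside the `CoaxialTwoSlabAdhesionOnWith`-conclusion of one pair (`R₀ = 10`). -/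
theorem coaxialOnWithConcl_weaken {C C' : ℝ}
    {A₁ : EuclideanSpace ℝ (Fin 3) ≃ₗᵢ[ℝ] EuclideanSpace ℝ (Fin 3)} {t₁ : EuclideanSpace ℝ (Fin 3)}
    {A₂ : EuclideanSpace ℝ (Fin 3) ≃ₗᵢ[ℝ] EuclideanSpace ℝ (Fin 3)} {t₂ : EuclideanSpace ℝ (Fin 3)} (hCC : C ≤ C')
    (h : ∃ (L : EuclideanSpace ℝ (Fin 3) ≃ₗᵢ[ℝ] EuclideanSpace ℝ (Fin 3))
        (s₁ s₂ : EuclideanSpace ℝ (Fin 3)) (σ σ' : ℤ → ℤ), IsHaggSeq σ ∧ IsHaggSeq σ' ∧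
        (fun p => A₁ p + t₁) '' fccStacking 1 (Real.sqrt (2 / 3)) ⊆
          (fun p => L p + s₁) '' barlowStacking 1 (Real.sqrt (2 / 3)) σ ∧
        (fun p => A₂ p + t₂) '' fccStacking 1 (Real.sqrt (2 / 3)) ⊆
          (fun p => L p + s₂) '' barlowStacking 1 (Real.sqrt (2 / 3)) σ' ∧
        TwoSlabLedgerWith C 10
          ((1 / 2 : ℝ) * Real.sqrt (1 - ⟪L (EuclideanSpace.single (2 : Fin 3) (1 : ℝ)),
            (EuclideanSpace.single (2 : Fin 3) (1 : ℝ))⟫_ℝ ^ 2)) A₁ t₁ A₂ t₂) :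
    ∃ (L : EuclideanSpace ℝ (Fin 3) ≃ₗᵢ[ℝ] EuclideanSpace ℝ (Fin 3))
        (s₁ s₂ : EuclideanSpace ℝ (Fin 3)) (σ σ' : ℤ → ℤ), IsHaggSeq σ ∧ IsHaggSeq σ' ∧
        (fun p => A₁ p + t₁) '' fccStacking 1 (Real.sqrt (2 / 3)) ⊆
          (fun p => L p + s₁) '' barlowStacking 1 (Real.sqrt (2 / 3)) σ ∧
        (fun p => A₂ p + t₂) '' fccStacking 1 (Real.sqrt (2 / 3)) ⊆
          (fun p => L p + s₂) '' barlowStacking 1 (Real.sqrt (2 / 3)) σ' ∧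
        TwoSlabLedgerWith C' 10
          ((1 / 2 : ℝ) * Real.sqrt (1 - ⟪L (EuclideanSpace.single (2 : Fin 3) (1 : ℝ)),
            (EuclideanSpace.single (2 : Fin 3) (1 : ℝ))⟫_ℝ ^ 2)) A₁ t₁ A₂ t₂ := by
  obtain ⟨L, s₁, s₂, σ, σ', hσ, hσ', h₁, h₂, hcell⟩ := h
  exact ⟨L, s₁, s₂, σ, σ', hσ, hσ', h₁, h₂, twoSlabLedgerWith_weaken (by norm_num) hCC hcell⟩

open scoped Classical in
/-- **The vicinal core at `(C_V, 10)` gives ALL co-axial pairs at one constant** (`coaxialTwoSlabAdhesion_of_vicinal` in the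
With-currency): non-triadic offsets, wide twins and wide slots are priced by the restated reach-cone links. -/
theorem coaxialOnWith_univ_of_vicinalWith
    {s₀ : EuclideanSpace ℝ (Fin 3)} (hs₀ : s₀ ∈ fccSlots)
    (hcert : ExactOnly 0 (fccSlots.filter fun w => 0 < ⟪w, s₀⟫_ℝ)) (hSP : StarPairFar)
    {C_V : ℝ} (hcore : CoaxialTwoSlabAdhesionOnWith C_V 10 VicinalPair) :
    ∃ C : ℝ, CoaxialTwoSlabAdhesionOnWith C 10 fun _ _ _ _ => True := by
  obtain ⟨K₁, hK₁⟩ := coaxialOnWith_of_not_triadic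
  obtain ⟨K₂, hK₂⟩ := coaxialOnWith_of_twin_wide
  obtain ⟨K₃, hK₃⟩ := coaxialOnWith_of_wide_slot
  refine ⟨max (max ((240 * Real.sqrt 2 * Real.pi + 4440 * (4 * 10 + 2)) / 2 + 2000 + K₁) ((240 * Real.sqrt 2 * Real.pi + 4440 * (4 * 10 + 2)) / 2 + 16000 + K₂))
    (max ((240 * Real.sqrt 2 * Real.pi + 4440 * (4 * 10 + 2)) / 2 + 16000 + K₃) C_V), ?_⟩
  intro A₁ t₁ A₂ t₂ hco hne _
  by_cases ht : ∃ j : ℕ, ((3 : ℝ) ^ j) • A₁.symm (t₂ - t₁) ∈ fccStacking 1 (Real.sqrt (2 / 3))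
  swap
  · exact coaxialOnWithConcl_weaken ((le_max_left _ _).trans (le_max_left _ _)) (hK₁ hs₀ hcert hSP A₁ t₁ A₂ t₂ hco ht)
  by_cases hvic : ∀ ν : EuclideanSpace ℝ (Fin 3), ‖ν‖ = 1 →
      (∀ w ∈ fccSlots, ⟪A₁ w, ν⟫_ℝ = 0 ∨ ⟪A₁ w, ν⟫_ℝ = Real.sqrt (2 / 3) ∨ ⟪A₁ w, ν⟫_ℝ = -Real.sqrt (2 / 3)) →
      A₂ '' fccStacking 1 (Real.sqrt (2 / 3)) = twinFrame A₁ ν '' fccStacking 1 (Real.sqrt (2 / 3)) →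
      Real.sqrt 3 / 2 * Real.sqrt (1 - ⟪ν, EuclideanSpace.single (2 : Fin 3) (1 : ℝ)⟫_ℝ ^ 2) < 9 / 20
  swap
  · push Not at hvic
    obtain ⟨ν, hν, hmenu, htwin, hwide⟩ := hvic
    exact coaxialOnWithConcl_weaken ((le_max_right _ _).trans (le_max_left _ _))
      (hK₂ hs₀ hcert hSP A₁ t₁ A₂ t₂ hν hmenu htwin hwide)
  by_cases hreg : A₁.symm ((3 : ℝ) • (t₂ - t₁)) ∈ fccStacking 1 (Real.sqrt (2 / 3)) →
      ∀ m : EuclideanSpace ℝ (Fin 3), ‖m‖ = 1 →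
      (∀ w ∈ fccSlots, ⟪A₁ w, m⟫_ℝ = 0 ∨ ⟪A₁ w, m⟫_ℝ = Real.sqrt (2 / 3) ∨ ⟪A₁ w, m⟫_ℝ = -Real.sqrt (2 / 3)) →
      (A₂ '' fccStacking 1 (Real.sqrt (2 / 3)) = A₁ '' fccStacking 1 (Real.sqrt (2 / 3)) ∨
        A₂ '' fccStacking 1 (Real.sqrt (2 / 3)) = twinFrame A₁ m '' fccStacking 1 (Real.sqrt (2 / 3))) →
      ∀ u₁ ∈ fccSlots, (9 / 20 : ℝ) ≤ ⟪A₁ u₁, EuclideanSpace.single (2 : Fin 3) (1 : ℝ)⟫_ℝ →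
      Real.sqrt (1 - ⟪m, EuclideanSpace.single (2 : Fin 3) (1 : ℝ)⟫_ℝ ^ 2) ≤
        Real.sqrt 2 * ⟪A₁ u₁, EuclideanSpace.single (2 : Fin 3) (1 : ℝ)⟫_ℝ →
      ∀ n₁ : EuclideanSpace ℝ (Fin 3), ‖n₁‖ = 1 →
      (∀ w ∈ fccSlots, ⟪A₁ w, n₁⟫_ℝ = 0 ∨ ⟪A₁ w, n₁⟫_ℝ = Real.sqrt (2 / 3) ∨ ⟪A₁ w, n₁⟫_ℝ = -Real.sqrt (2 / 3)) →
      ⟪A₁ u₁, n₁⟫_ℝ = Real.sqrt (2 / 3) →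
      (A₂ '' fccStacking 1 (Real.sqrt (2 / 3)) = A₁ '' fccStacking 1 (Real.sqrt (2 / 3)) ∨
        A₂ '' fccStacking 1 (Real.sqrt (2 / 3)) = twinFrame A₁ n₁ '' fccStacking 1 (Real.sqrt (2 / 3))) →
      ∃ a b : ℤ, A₁.symm (t₂ - t₁ - (a : ℝ) • (Real.sqrt (2 / 3) • n₁) -
        (b : ℝ) • (Real.sqrt (2 / 3) • ((2 * Real.sqrt (2 / 3)) • A₁ u₁ - n₁))) ∈ fccStacking 1 (Real.sqrt (2 / 3))
  · exact coaxialOnWithConcl_weaken (le_max_right _ _ |>.trans' (le_max_right _ _) |> fun h => h)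
      (hcore A₁ t₁ A₂ t₂ hco hne ⟨ht, hvic, hreg⟩)
  push Not at hreg
  obtain ⟨h3, m, hm, hmenum, hadm, u₁, hu₁, hup, hdom, n₁, hn₁, hmenu₁, hun, hΛ, hnot⟩ := hreg
  exact coaxialOnWithConcl_weaken ((le_max_left _ _).trans (le_max_right _ _))
    (hK₃ hs₀ hcert hSP A₁ t₁ A₂ t₂ hm hmenum hadm hu₁ hup hdom hn₁ hmenu₁ hun hΛ h3 hnot)

open scoped Classical in
/-- **The reach core at `(C_R, 10)` gives the vicinal core at one constant** (`coaxialTwoSlabAdhesion_of_reach`'s registry step in the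
With-currency): a vicinal pair NOT registered for some admissible vertical is priced by `coaxialOnWith_of_offReach`. -/
theorem coaxialOnWith_vicinal_of_reachWith
    {s₀ : EuclideanSpace ℝ (Fin 3)} (hs₀ : s₀ ∈ fccSlots)
    (hcert : ExactOnly 0 (fccSlots.filter fun w => 0 < ⟪w, s₀⟫_ℝ)) (hSP : StarPairFar)
    {C_R : ℝ} (hcore : CoaxialTwoSlabAdhesionOnWith C_R 10 ReachPair) :
    ∃ C : ℝ, CoaxialTwoSlabAdhesionOnWith C 10 VicinalPair := by
  obtain ⟨K, hK⟩ := coaxialOnWith_of_offReach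
  refine ⟨max C_R ((240 * Real.sqrt 2 * Real.pi + 4440 * (4 * 10 + 2)) / 2 + 16000 + K), ?_⟩
  intro A₁ t₁ A₂ t₂ hco hne hV
  by_cases hR : ∀ z : EuclideanSpace ℝ (Fin 3), ‖z‖ = 1 → ‖z - EuclideanSpace.single (2 : Fin 3) (1 : ℝ)‖ ≤ 1 / 3 →
    ∀ u ∈ fccSlots, Real.sqrt 2 / 2 ≤ ⟪A₁ u, z⟫_ℝ →
    ∀ m : EuclideanSpace ℝ (Fin 3), ‖m‖ = 1 →
    (∀ w ∈ fccSlots, ⟪A₁ w, m⟫_ℝ = 0 ∨ ⟪A₁ w, m⟫_ℝ = Real.sqrt (2 / 3) ∨ ⟪A₁ w, m⟫_ℝ = -Real.sqrt (2 / 3)) →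
    (A₂ '' fccStacking 1 (Real.sqrt (2 / 3)) = A₁ '' fccStacking 1 (Real.sqrt (2 / 3)) ∨
      A₂ '' fccStacking 1 (Real.sqrt (2 / 3)) = twinFrame A₁ m '' fccStacking 1 (Real.sqrt (2 / 3))) →
    Real.sqrt (1 - ⟪m, EuclideanSpace.single (2 : Fin 3) (1 : ℝ)⟫_ℝ ^ 2) ≤
      Real.sqrt 2 * ⟪A₁ u, EuclideanSpace.single (2 : Fin 3) (1 : ℝ)⟫_ℝ →
    ∃ y ∈ reachSet A₁ t₁ (chainFrames z A₁ u), y ∈ (fun q => A₂ q + t₂) '' fccStacking 1 (Real.sqrt (2 / 3))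
  · exact coaxialOnWithConcl_weaken (le_max_left _ _) (hcore A₁ t₁ A₂ t₂ hco hne ⟨hV, hR⟩)
  push Not at hR
  obtain ⟨z, hz, hze, u, hu, hsteep, m, hm, hmenum, hadm, hdom, hoff⟩ := hR
  exact coaxialOnWithConcl_weaken (le_max_right _ _)
    (hK hs₀ hcert hSP A₁ t₁ A₂ t₂ hz hze hu hsteep hm hmenum hadm hdom hoff)

/-- **Re-assembly of the reach core from the three reach debts, at explicit constants** (`coaxialTwoSlabAdhesionReach_of_split` in the
With-currency): R1 (coherent twins), R2 (coherent faults), R3 (deep incoherent) at `(Cᵢ, 10)` give the reach core at `max`. -/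
theorem coaxialOnWith_reach_of_splitWith {C₁ C₂ C₃ : ℝ}
    (h₁ : CoaxialTwoSlabAdhesionOnWith C₁ 10 fun A₁ t₁ A₂ t₂ => ReachPair A₁ t₁ A₂ t₂ ∧ CoherentTwinPair A₁ t₁ A₂ t₂)
    (h₂ : CoaxialTwoSlabAdhesionOnWith C₂ 10 fun A₁ t₁ A₂ t₂ =>
      (ReachPair A₁ t₁ A₂ t₂ ∧ ¬ CoherentTwinPair A₁ t₁ A₂ t₂) ∧ CoherentFaultPair A₁ t₁ A₂ t₂)
    (h₃ : CoaxialTwoSlabAdhesionOnWith C₃ 10 fun A₁ t₁ A₂ t₂ =>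
      ((ReachPair A₁ t₁ A₂ t₂ ∧ ¬ CoherentTwinPair A₁ t₁ A₂ t₂) ∧ ¬ CoherentFaultPair A₁ t₁ A₂ t₂) ∧ DeepPair A₁ t₁ A₂ t₂) :
    CoaxialTwoSlabAdhesionOnWith (max C₁ (max C₂ C₃)) 10 ReachPair := by
  refine coaxialTwoSlabAdhesionOnWith_split_max (by norm_num) CoherentTwinPair h₁
    (coaxialTwoSlabAdhesionOnWith_split_max (by norm_num) CoherentFaultPair h₂ ?_)
  intro A₁ t₁ A₂ t₂ hco hne hS
  exact h₃ A₁ t₁ A₂ t₂ hco hne ⟨hS, deepPair_of_incoherent A₁ t₁ A₂ t₂ hco hS.1.1.1 hS.1.2 hS.2⟩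

/-- **Lane F's UNIFORM law at `R₀ = 10` from the reach core in the With-currency**, modulo E1 (`ExactOnly` at a slot star) and
`StarPairFar`. -/
theorem coaxialTwoSlabAdhesionUnifAt_ten_of_reachWith
    {s₀ : EuclideanSpace ℝ (Fin 3)} (hs₀ : s₀ ∈ fccSlots)
    (hcert : ExactOnly 0 (fccSlots.filter fun w => 0 < ⟪w, s₀⟫_ℝ)) (hSP : StarPairFar)
    {C_R : ℝ} (hcore : CoaxialTwoSlabAdhesionOnWith C_R 10 ReachPair) :
    ∃ C : ℝ, CoaxialTwoSlabAdhesionUnifAt C 10 := by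
  obtain ⟨C_V, hV⟩ := coaxialOnWith_vicinal_of_reachWith hs₀ hcert hSP hcore
  obtain ⟨C, hC⟩ := coaxialOnWith_univ_of_vicinalWith hs₀ hcert hSP hV
  exact ⟨C, (coaxialTwoSlabAdhesionUnifAt_iff_onWith_univ C 10).2 hC⟩

/-- **The same from the three reach debts at explicit constants.** -/
theorem coaxialTwoSlabAdhesionUnifAt_ten_of_splitWith
    {s₀ : EuclideanSpace ℝ (Fin 3)} (hs₀ : s₀ ∈ fccSlots)
    (hcert : ExactOnly 0 (fccSlots.filter fun w => 0 < ⟪w, s₀⟫_ℝ)) (hSP : StarPairFar) {C₁ C₂ C₃ : ℝ}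
    (h₁ : CoaxialTwoSlabAdhesionOnWith C₁ 10 fun A₁ t₁ A₂ t₂ => ReachPair A₁ t₁ A₂ t₂ ∧ CoherentTwinPair A₁ t₁ A₂ t₂)
    (h₂ : CoaxialTwoSlabAdhesionOnWith C₂ 10 fun A₁ t₁ A₂ t₂ =>
      (ReachPair A₁ t₁ A₂ t₂ ∧ ¬ CoherentTwinPair A₁ t₁ A₂ t₂) ∧ CoherentFaultPair A₁ t₁ A₂ t₂)
    (h₃ : CoaxialTwoSlabAdhesionOnWith C₃ 10 fun A₁ t₁ A₂ t₂ =>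
      ((ReachPair A₁ t₁ A₂ t₂ ∧ ¬ CoherentTwinPair A₁ t₁ A₂ t₂) ∧ ¬ CoherentFaultPair A₁ t₁ A₂ t₂) ∧ DeepPair A₁ t₁ A₂ t₂) :
    ∃ C : ℝ, CoaxialTwoSlabAdhesionUnifAt C 10 :=
  coaxialTwoSlabAdhesionUnifAt_ten_of_reachWith hs₀ hcert hSP (coaxialOnWith_reach_of_splitWith h₁ h₂ h₃)

/-- **F-U at `R₀ = 10` from `P5Exhaustion`, `StarPairFar` (both BY NAME) and the reach core in the With-currency.** -/
theorem coaxialTwoSlabAdhesionUnifAt_ten_of_reachWith_p5 (hE1 : P5Exhaustion) (hSP : StarPairFar)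
    {C_R : ℝ} (hcore : CoaxialTwoSlabAdhesionOnWith C_R 10 ReachPair) :
    ∃ C : ℝ, CoaxialTwoSlabAdhesionUnifAt C 10 := by
  classical
  obtain ⟨s₀, hs₀, hcert⟩ := exactOnly_star_of_p5Exhaustion hE1
  exact coaxialTwoSlabAdhesionUnifAt_ten_of_reachWith hs₀ hcert hSP hcore

end Summit.Ventures.Crystal3D.Theorems

end
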